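import Summits.BirchSwinnertonDyer.BirchSwinnertonDyer.Theses.PrintX10b
import Summits.BirchSwinnertonDyer.BirchSwinnertonDyer.Theorems.PrintX10bHowardRoad
import HarnessLib

/-!
# Line `composite-transfer-x10b` on crux stmt-BirchSwinnertonDyer-23730
# `PrintX10b.TwoSidedLinkAnyClassNumberX10b` (B₃, r304): the σ-bridge composition WITHOUT `sorry`,
# and the `3 ∤ h_K` regime (stub `stub_compositeValuationThree_coprimeClassNumber`) modulo the cite-only
# Yan–Zhu ∘ BCS ∘ CGLS composite

Cell `run/shared/lean/pub/bsd-print-x9/`, seat `bsd-line-x10b-p3` (D-0154 row 10, lead of the registered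
line `composite-transfer-x10b`, skeleton `Cruxes/TwoSidedLinkAnyClassNumberX10b/Lines/composite_transfer_x10b.lean`
sha `e8360039…`, 2 stubs). HONEST FRAMING: theorems only (no definition, no named fact, no `sorry`);
`--supports stmt-BirchSwinnertonDyer-23730`; the crux is NOT closed here; BSD is not proved by any of
this and no summit statement is proved by this seat.

* `twoSidedLinkAnyClassNumberX10b_of_compositeValuation_of_thm331` — B₃ from ONE class-number-free
  valuation statement (the composite "Yan–Zhu Thm. 5.7 (1) + Thm. 5.9 + BCS Prop. 4.2.2 + CGLS Thm. 5.1.3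
  GIVEN Howard's containment" at `p = 3` in the currency `AcSelmer.XAc.HasCharValuationAt … n ∧ n = 2·(ord_3
  (1 − a_3 + 3) − 1 + ord_3 log_ω P) − 2·ord_3 c(Dt)`, ANY class number) and the route's by-name item
  `JSWAnticyclotomicControl` (JSW 2017 Thm. 3.3.1, `p ≥ 3`, class-number-free): the σ-bridge of
  `PrintX9HowardIMCLink` §1 (the other prime `w ∣ 3`, THE embedding `embAt w`, an involution `σ` with
  `ι_w = ι ∘ σ`, `ord_3 log` invariance in rank one — all the tree's `X11b.*` API at every `p ≥ 3`).
* `twoSidedLinkAnyClassNumberX10b_of_regimes_of_thm331` — the registered composition: the same from the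
  two registered stub statements (split by `3 ∣ h_K`), i.e. the skeleton's `TwoSidedLinkAnyClassNumberX10b_of`
  with the `Stmt.stub_*` abbreviations unfolded.
* `compositeValuationThree_coprimeClassNumber_of_composite` — the `3 ∤ h_K` regime (= the registered stub
  `stub_compositeValuationThree_coprimeClassNumber`, verbatim body) MODULO the cite-only composite named fact
  `YanZhu2026.thm57_thm59_bcs422_cgls513_generator_constantCoeff_of_heegnerDivisibility` (itself a THEOREM
  from the four single-source facts, `X11b.YZComposite.…_of_printFacts`): one application of
  `YanZhu2026.hasCharValuationAt_of_heegnerDivisibility`.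

What is NOT here: the `3 ∣ h_K` regime. Its only class-number entry in the tree is the field
`YanZhu2026.Thm57Hypotheses.not_dvd_classNumber` consumed by the typed Thm. 5.9 (the Heegner ⟺ BDP
transfer); Thm. 5.7 (1) is used RATIONALLY (class-number-free as typed), Prop. 4.2.2 / Thm. 5.1.3 / JSW
3.3.1 carry no class-number hypothesis. See the companion file `…OfPrintFacts` (same seat).

References: [YanZhu2024MainConjNonCM] Thm. 5.7 (1), Thm. 5.9; [BurungaleCastellaSkinner2025] Prop.
4.2.2; [CastellaGrossiLeeSkinner2022] Thm. 5.1.3; [JetchevSkinnerWan2017] Thm. 3.3.1, §7.4.1;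
[Castella2018] Thm. 2.3, §5 (eq:IMC+BDP).
-/

-- the summit and its single problem are both named `BirchSwinnertonDyer` (registry layout D-0017)
set_option linter.dupNamespace false
set_option autoImplicit false

noncomputable section

open scoped Classical

open WeierstrassCurve NumberField IsDedekindDomain Field Literature.NumberTheory.EllipticCurves
  Literature.NumberTheory.EllipticCurves.ModularForms Literature.NumberTheory.EllipticCurves.YanZhu2026
  Literature.NumberTheory.EllipticCurves.JetchevSkinnerWan2017 Literature.NumberTheory.EllipticCurves.Castella2018

open Summit.BirchSwinnertonDyer.Rank1Residual
open Literature.NumberTheory.EllipticCurves.Rank1Residual (ClassX10 Surj)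

namespace Summit.BirchSwinnertonDyer.BirchSwinnertonDyer.Cruxes.TwoSidedLinkAnyClassNumberX10b.CompositeTransferX10b

/-! ## §1 B₃ from ONE class-number-free valuation statement and JSW Thm. 3.3.1 (the σ-bridge) -/

/-- **B₃ ⇐ the composite valuation identity at `p = 3` (ANY class number) + JSW 2017 Thm. 3.3.1.** Granted,
at every `p = 3` good-ordinary frame (`K` imaginary quadratic, Heegner for `N_E` and for `3`, `d_K` odd
`≠ −3`, (irr_K), `ι`, the two primes `v` (induced by `ι`) and `v̄ ∋ 3`, `κ` anticyclotomic with generator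
`γ`, a parametrisation datum `Dt` at any level `N`, a Heegner datum `H`, `P ↦ y_K`), Howard's containment
and ONE generator `G` of `Char_Λ(X_ac)` (strict at `v̄`) with `G(0) ≠ 0`, the valuation identity
`ord_3 G(0) = 2·(ord_3(1 − a_3 + 3) − 1 + ord_3 log_ω P) − 2·ord_3 c(Dt)` — the conclusion of the route
item `TwoSidedLinkAnyClassNumberX10b` follows with the route's by-name item `JSWAnticyclotomicControl`
supplying the generator: `ClassX10` gives `p = 3` and `GoodOrd W 3`; JSW at `(ι, inducedPlace ι)` gives
`G`; the valuation statement is applied at THE embedding `embAt w` of the other prime `w ∣ 3` with strict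
prime `inducedPlace ι`; `embAt w = ι ∘ σ` for an involution `σ` and `ord_3 log_{ι∘σ} P = ord_3 log_ι P` in
rank one; `ord_3 c(Dt) = 0` as `3 ∤ c(Dt)`. The skeleton's σ-bridge (= `PrintX9HowardIMCLink` §1).
[cite: JetchevSkinnerWan2017, Thm. 3.3.1 and §7.4.1] [cite: Castella2018, Thm. 2.3, §5 (eq:IMC+BDP)] -/
theorem twoSidedLinkAnyClassNumberX10b_of_compositeValuation_of_thm331
    (hval : ∀ (W : WeierstrassCurve ℚ) [W.IsElliptic] [W.IsGloballyMinimal] (p : ℕ) [Fact p.Prime],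
      p = 3 → Literature.NumberTheory.EllipticCurves.Rank1Residual.GoodOrd W p →
      ∀ (K : Type) [Field K] [NumberField K], IsImaginaryQuadratic K →
        SatisfiesHeegnerHypothesis (W.conductorNorm ℤ) K → SatisfiesHeegnerHypothesis p K →
        Odd (NumberField.discr K) → NumberField.discr K ≠ -3 →
        (W.baseChange K).HasIrreducibleModPGaloisRep p →
      ∀ (ι : K →+* ℚ_[p]) (v vbar : HeightOneSpectrum (𝓞 K)),
        (∀ x : 𝓞 K, x ∈ v.asIdeal ↔ ‖ι (x : K)‖ < 1) →
        ((p : ℕ) : 𝓞 K) ∈ vbar.asIdeal → vbar ≠ v →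
      ∀ (κ : ZpExtension K p), κ.IsAnticyclotomic →
      ∀ (γ : absoluteGaloisGroup K) [Fact (κ.IsTopGenerator γ)],
      ∀ (N : ℕ) [NeZero N] (Dt : ModularParametrizationData W N)
        (H : HeegnerDatum N (NumberField.discr K)) (ιC : K →+* ℂ) (P : (W.baseChange K).toAffine.Point),
        WeierstrassCurve.Affine.Point.map ιC.toRatAlgHom P = heegnerPointComplex Dt H →
        (∃ (jbar : AlgebraicClosure K →+* ℂ) (D : (W.baseChange K).LambdaAdicSelmerData κ γ)
            (F : HeegnerFamily N W K κ jbar) (X : (W.baseChange K).SelmerDualData κ γ),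
            heegnerCharIdeal D F ^ 2 ≤
              Module.charIdeal (IwasawaAlgebra p) (Submodule.torsion (IwasawaAlgebra p) X.X)) →
      ∀ (G : IwasawaAlgebra p),
        AcSelmer.XAc.charIdeal (W.baseChange K) p κ vbar ∅ γ = Ideal.span {G} →
        PowerSeries.constantCoeff G ≠ 0 →
        ∃ n : ℕ, AcSelmer.XAc.HasCharValuationAt (W.baseChange K) p κ vbar ∅ γ n ∧
          (n : ℤ) = 2 * ((padicValInt p (1 - W.frobeniusTrace p + p) : ℤ) - 1 +
            Literature.NumberTheory.EllipticCurves.padicLogOrd W p ι P) - 2 * (padicValInt p Dt.c : ℤ))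
    (h331 : Summit.BirchSwinnertonDyer.BirchSwinnertonDyer.Theses.PrintX10b.JSWAnticyclotomicControl) :
    Summit.BirchSwinnertonDyer.BirchSwinnertonDyer.Theses.PrintX10b.TwoSidedLinkAnyClassNumberX10b := by
  have h331' : thm331_anticyclotomicControl := h331
  intro W _ _ p _ _ K _ _ hX hns hcm hK hodd h3 hHN hHp hirrK ι κ hκ γ _ Dt hc H ιC P hP hrk hfinp
    hPinf hHow
  have hp3 : p = 3 := hX.p_eq
  have hp : 3 ≤ p := hX.three_le
  obtain ⟨hgood, hord⟩ := id hX.goodOrd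
  -- the other prime `w` above `p`, of degree one, and THE embedding at it
  obtain ⟨w, hw, hwne⟩ := X11b.exists_other_prime hHp (X11b.inducedPlace ι)
    (X11b.natCast_mem_inducedPlace ι)
  have hsplit : X11b.SplitsIn K p := hHp p Fact.out (dvd_refl p)
  obtain ⟨he, hf⟩ := X11b.degreeOne_of_splitsIn hK.1 hsplit hw
  set ιw : K →+* ℚ_[p] := X11b.embAt K p w hw he hf with hιw
  -- a generator with non-zero constant term of the module strict at `v = inducedPlace ι`, from JSW
  obtain ⟨-, F, hF, hF0, -⟩ := h331' W p hp hgood K hK hHp hHN hirrK ι (X11b.inducedPlace ι)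
    (X11b.mem_inducedPlace_iff ι) κ hκ γ hrk hfinp P hPinf
  -- the composite (any class number) at the embedding `ιw`, strict prime `inducedPlace ι`
  obtain ⟨n, hn, hval'⟩ := hval W p hp3 ⟨hgood, hord⟩ K hK hHN hHp hodd h3 hirrK ιw w
    (X11b.inducedPlace ι) (X11b.mem_asIdeal_iff_norm_embAt_lt_one w hw he hf)
    (X11b.natCast_mem_inducedPlace ι) (fun h ↦ hwne h.symm) κ hκ γ (W.conductorNorm ℤ) Dt H ιC P hP
    hHow F hF hF0
  -- `ιw = ι ∘ σ` for an involution `σ`; the log valuations agree in rank one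
  obtain ⟨σ, hσ, hισ⟩ := X11b.exists_involutive_comp_eq hK.1 ι ιw
  have hlog : Literature.NumberTheory.EllipticCurves.padicLogOrd W p ιw P = X11b.padicLogOrd W p ι P := by
    rw [← hισ, ← X11b.padicLogOrd_eq_literature]
    exact padicLogOrd_comp_eq_of_rank_one W p (by omega) σ hσ ι hrk P hPinf
  have hc0 : padicValInt p Dt.c = 0 := padicValInt.eq_zero_of_not_dvd hc
  refine ⟨n, (X11b.AcSelmer.hasCharValuationAt_iff_literature _ p κ (X11b.inducedPlace ι) ∅ γ n).mpr hn,
    ?_⟩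
  rw [hlog] at hval'
  omega

/-! ## §2 The registered composition: B₃ ⇐ B₃¹ (`3 ∣ h_K`) + B₃⁰ (`3 ∤ h_K`) + JSW Thm. 3.3.1 -/

/-- **The registered composition of line `composite-transfer-x10b`** (skeleton `e8360039…`, its
`TwoSidedLinkAnyClassNumberX10b_of` with the abbreviations `Stmt.stub_*` unfolded): B₃ from the two
registered stub statements — `h1` = `stub_compositeValuationThree_divisibleClassNumber` (the regime
`3 ∣ h_K`), `h2` = `stub_compositeValuationThree_coprimeClassNumber` (the regime `3 ∤ h_K`) — and the route's
by-name item `JSWAnticyclotomicControl`, by the case split on `3 ∣ h_K` feeding §1.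
[cite: JetchevSkinnerWan2017, Thm. 3.3.1 and §7.4.1] [cite: Castella2018, Thm. 2.3, §5 (eq:IMC+BDP)] -/
theorem twoSidedLinkAnyClassNumberX10b_of_regimes_of_thm331
    (h1 : ∀ (W : WeierstrassCurve ℚ) [W.IsElliptic] [W.IsGloballyMinimal] (p : ℕ) [Fact p.Prime],
      p = 3 → Literature.NumberTheory.EllipticCurves.Rank1Residual.GoodOrd W p →
      ∀ (K : Type) [Field K] [NumberField K], IsImaginaryQuadratic K →
        SatisfiesHeegnerHypothesis (W.conductorNorm ℤ) K → SatisfiesHeegnerHypothesis p K →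
        Odd (NumberField.discr K) → NumberField.discr K ≠ -3 →
        (W.baseChange K).HasIrreducibleModPGaloisRep p →
        p ∣ NumberField.classNumber K →
      ∀ (ι : K →+* ℚ_[p]) (v vbar : HeightOneSpectrum (𝓞 K)),
        (∀ x : 𝓞 K, x ∈ v.asIdeal ↔ ‖ι (x : K)‖ < 1) →
        ((p : ℕ) : 𝓞 K) ∈ vbar.asIdeal → vbar ≠ v →
      ∀ (κ : ZpExtension K p), κ.IsAnticyclotomic →
      ∀ (γ : absoluteGaloisGroup K) [Fact (κ.IsTopGenerator γ)],
      ∀ (N : ℕ) [NeZero N] (Dt : ModularParametrizationData W N)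
        (H : HeegnerDatum N (NumberField.discr K)) (ιC : K →+* ℂ) (P : (W.baseChange K).toAffine.Point),
        WeierstrassCurve.Affine.Point.map ιC.toRatAlgHom P = heegnerPointComplex Dt H →
        (∃ (jbar : AlgebraicClosure K →+* ℂ) (D : (W.baseChange K).LambdaAdicSelmerData κ γ)
            (F : HeegnerFamily N W K κ jbar) (X : (W.baseChange K).SelmerDualData κ γ),
            heegnerCharIdeal D F ^ 2 ≤
              Module.charIdeal (IwasawaAlgebra p) (Submodule.torsion (IwasawaAlgebra p) X.X)) →
      ∀ (G : IwasawaAlgebra p),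
        AcSelmer.XAc.charIdeal (W.baseChange K) p κ vbar ∅ γ = Ideal.span {G} →
        PowerSeries.constantCoeff G ≠ 0 →
        ∃ n : ℕ, AcSelmer.XAc.HasCharValuationAt (W.baseChange K) p κ vbar ∅ γ n ∧
          (n : ℤ) = 2 * ((padicValInt p (1 - W.frobeniusTrace p + p) : ℤ) - 1 +
            Literature.NumberTheory.EllipticCurves.padicLogOrd W p ι P) - 2 * (padicValInt p Dt.c : ℤ))
    (h2 : ∀ (W : WeierstrassCurve ℚ) [W.IsElliptic] [W.IsGloballyMinimal] (p : ℕ) [Fact p.Prime],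
      p = 3 → Literature.NumberTheory.EllipticCurves.Rank1Residual.GoodOrd W p →
      ∀ (K : Type) [Field K] [NumberField K], IsImaginaryQuadratic K →
        SatisfiesHeegnerHypothesis (W.conductorNorm ℤ) K → SatisfiesHeegnerHypothesis p K →
        Odd (NumberField.discr K) → NumberField.discr K ≠ -3 →
        (W.baseChange K).HasIrreducibleModPGaloisRep p →
        ¬ p ∣ NumberField.classNumber K →
      ∀ (ι : K →+* ℚ_[p]) (v vbar : HeightOneSpectrum (𝓞 K)),
        (∀ x : 𝓞 K, x ∈ v.asIdeal ↔ ‖ι (x : K)‖ < 1) →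
        ((p : ℕ) : 𝓞 K) ∈ vbar.asIdeal → vbar ≠ v →
      ∀ (κ : ZpExtension K p), κ.IsAnticyclotomic →
      ∀ (γ : absoluteGaloisGroup K) [Fact (κ.IsTopGenerator γ)],
      ∀ (N : ℕ) [NeZero N] (Dt : ModularParametrizationData W N)
        (H : HeegnerDatum N (NumberField.discr K)) (ιC : K →+* ℂ) (P : (W.baseChange K).toAffine.Point),
        WeierstrassCurve.Affine.Point.map ιC.toRatAlgHom P = heegnerPointComplex Dt H →
        (∃ (jbar : AlgebraicClosure K →+* ℂ) (D : (W.baseChange K).LambdaAdicSelmerData κ γ)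
            (F : HeegnerFamily N W K κ jbar) (X : (W.baseChange K).SelmerDualData κ γ),
            heegnerCharIdeal D F ^ 2 ≤
              Module.charIdeal (IwasawaAlgebra p) (Submodule.torsion (IwasawaAlgebra p) X.X)) →
      ∀ (G : IwasawaAlgebra p),
        AcSelmer.XAc.charIdeal (W.baseChange K) p κ vbar ∅ γ = Ideal.span {G} →
        PowerSeries.constantCoeff G ≠ 0 →
        ∃ n : ℕ, AcSelmer.XAc.HasCharValuationAt (W.baseChange K) p κ vbar ∅ γ n ∧
          (n : ℤ) = 2 * ((padicValInt p (1 - W.frobeniusTrace p + p) : ℤ) - 1 +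
            Literature.NumberTheory.EllipticCurves.padicLogOrd W p ι P) - 2 * (padicValInt p Dt.c : ℤ))
    (h331 : Summit.BirchSwinnertonDyer.BirchSwinnertonDyer.Theses.PrintX10b.JSWAnticyclotomicControl) :
    Summit.BirchSwinnertonDyer.BirchSwinnertonDyer.Theses.PrintX10b.TwoSidedLinkAnyClassNumberX10b := by
  refine twoSidedLinkAnyClassNumberX10b_of_compositeValuation_of_thm331 ?_ h331
  intro W _ _ p _ hp3 hgo K _ _ hK hHN hHp hodd h3 hirrK ι v vbar hv hvbar hne κ hκ γ _ N _ Dt H ιC P hP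
    hHow G hG hG0
  by_cases hhK : p ∣ NumberField.classNumber K
  · exact h1 W p hp3 hgo K hK hHN hHp hodd h3 hirrK hhK ι v vbar hv hvbar hne κ hκ γ N Dt H ιC P hP hHow G
      hG hG0
  · exact h2 W p hp3 hgo K hK hHN hHp hodd h3 hirrK hhK ι v vbar hv hvbar hne κ hκ γ N Dt H ιC P hP hHow G
      hG hG0

/-! ## §3 The `3 ∤ h_K` regime is PRINT modulo the cite-only composite named fact -/

/-- **The regime `3 ∤ h_K` of the composite valuation identity (the registered stub
`stub_compositeValuationThree_coprimeClassNumber`, verbatim body) MODULO the cite-only composite named fact**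
`YanZhu2026.thm57_thm59_bcs422_cgls513_generator_constantCoeff_of_heegnerDivisibility` (Yan–Zhu 2026 Thm.
5.7 (1) rational + Thm. 5.9 + BCS 2025 Prop. 4.2.2 + CGLS 2022 Thm. 5.1.3, granted Howard's containment;
valid as printed at every `p > 2`, proof-level flag `YZ26@3-BF-ERL-Ohta` at `p = 3`; a THEOREM from the
four single-source facts by `X11b.YZComposite.thm57_thm59_bcs422_cgls513_of_heegnerDivisibility_of_printFacts`):
`YanZhu2026.hasCharValuationAt_of_heegnerDivisibility` read at `p = 3`.
[cite: YanZhu2024MainConjNonCM, Thm. 5.7 (1) and Thm. 5.9] [cite: BurungaleCastellaSkinner2025, Prop. 4.2.2]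
[cite: CastellaGrossiLeeSkinner2022, Thm. 5.1.3] -/
theorem compositeValuationThree_coprimeClassNumber_of_composite
    (hYZ : thm57_thm59_bcs422_cgls513_generator_constantCoeff_of_heegnerDivisibility) :
    ∀ (W : WeierstrassCurve ℚ) [W.IsElliptic] [W.IsGloballyMinimal] (p : ℕ) [Fact p.Prime],
      p = 3 → Literature.NumberTheory.EllipticCurves.Rank1Residual.GoodOrd W p →
      ∀ (K : Type) [Field K] [NumberField K], IsImaginaryQuadratic K →
        SatisfiesHeegnerHypothesis (W.conductorNorm ℤ) K → SatisfiesHeegnerHypothesis p K →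
        Odd (NumberField.discr K) → NumberField.discr K ≠ -3 →
        (W.baseChange K).HasIrreducibleModPGaloisRep p →
        ¬ p ∣ NumberField.classNumber K →
      ∀ (ι : K →+* ℚ_[p]) (v vbar : HeightOneSpectrum (𝓞 K)),
        (∀ x : 𝓞 K, x ∈ v.asIdeal ↔ ‖ι (x : K)‖ < 1) →
        ((p : ℕ) : 𝓞 K) ∈ vbar.asIdeal → vbar ≠ v →
      ∀ (κ : ZpExtension K p), κ.IsAnticyclotomic →
      ∀ (γ : absoluteGaloisGroup K) [Fact (κ.IsTopGenerator γ)],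
      ∀ (N : ℕ) [NeZero N] (Dt : ModularParametrizationData W N)
        (H : HeegnerDatum N (NumberField.discr K)) (ιC : K →+* ℂ) (P : (W.baseChange K).toAffine.Point),
        WeierstrassCurve.Affine.Point.map ιC.toRatAlgHom P = heegnerPointComplex Dt H →
        (∃ (jbar : AlgebraicClosure K →+* ℂ) (D : (W.baseChange K).LambdaAdicSelmerData κ γ)
            (F : HeegnerFamily N W K κ jbar) (X : (W.baseChange K).SelmerDualData κ γ),
            heegnerCharIdeal D F ^ 2 ≤
              Module.charIdeal (IwasawaAlgebra p) (Submodule.torsion (IwasawaAlgebra p) X.X)) →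
      ∀ (G : IwasawaAlgebra p),
        AcSelmer.XAc.charIdeal (W.baseChange K) p κ vbar ∅ γ = Ideal.span {G} →
        PowerSeries.constantCoeff G ≠ 0 →
        ∃ n : ℕ, AcSelmer.XAc.HasCharValuationAt (W.baseChange K) p κ vbar ∅ γ n ∧
          (n : ℤ) = 2 * ((padicValInt p (1 - W.frobeniusTrace p + p) : ℤ) - 1 +
            Literature.NumberTheory.EllipticCurves.padicLogOrd W p ι P) - 2 * (padicValInt p Dt.c : ℤ) := by
  intro W _ _ p _ hp3 hgo K _ _ hK hHN hHp hodd h3 hirrK hhK ι v vbar hv hvbar hne κ hκ γ _ N _ Dt H ιC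
    P hP hHow G hG hG0
  exact hasCharValuationAt_of_heegnerDivisibility hYZ (by omega) hgo K hK hHN hHp hodd h3 hirrK hhK ι v
    vbar hv hvbar hne κ hκ γ Dt H ιC P hP hHow G hG hG0

end Summit.BirchSwinnertonDyer.BirchSwinnertonDyer.Cruxes.TwoSidedLinkAnyClassNumberX10b.CompositeTransferX10b

end
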